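import Summits.HodgeConjecture.HodgeConjecture.Theorems.F0P3cStCharTSUpTrTubeAnyCartan   -- ★ (N4-B) `setIntegral_mul_classFun_cartanSet_eq` (this seat); brings ★ (N4-A) `sqrt_dgRadicand_conj`, ★ (E1b), ★ (E3), ★ (E0) `…WeylCartanRadial`
import HarnessLib

/-!
# F0 · P3c · ROAD «UP-TR» brick (N4-C): THE «W-UNFOLDED» TUBE FORMULA AT ANY CARTAN `T = Z(γ₀)` OF `U(Φ₃)(L⁺_v)` FOR A NON-INVARIANT TORUS WEIGHT — TORSOR re-indexing
# of the orbit sum and `N(T)`-invariance of the canonical torus measure (Rogawski 1990 §12.5 p. 182; Harish-Chandra 1970 Lemma 42)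

Cell `pub/hodgecm-mathlib`, crux H413 = `stmt-HodgeConjecture-24833` (lane `--supports … --as helper`); seat LH10-p01 (g8); ROAD «UP-TR» v2 (holder F0P3-p02 (g23)) §B brick
(N4) «TUBE-ANY-CARTAN-G», FILE C of 3 (FILE A = ★ `…UpTrTubeSocketAnyCartan`, FILE B = ★ `…UpTrTubeAnyCartan`).  THEOREMS ONLY; sorry-free; no definition ∕ instance ∕ notation ∕ named fact; ★-only imports; axioms TRIO.

WHAT (all at ANY Cartan `T = Z(γ₀)`, `γ₀` regular, `v` non-split; `tT` THE Haar measure of `T` with inversion symmetry and `tT (compactCore T) = 1`; `ν` Haar; weight letter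
`D(t) = √(∏_w |disc χ_t|_w · (∏_w |det t|_w)⁻²)` (= `D_G(t)²` under the datum's `eDG`, ★ `DG_sq_eq_sqrt`); `G_T = ⋃ₓ x T^{reg} x⁻¹`; `[N:T] = (T.subgroupOf N_G(T)).index`):
* (a)(a′)(b) — the `∫⁻` ∕ Bochner ∕ class-function tube formulas at any Cartan — are FILE B ★ `…UpTrTubeAnyCartan`; this file is (c):
* (c) **`setIntegral_mul_orbitSum_cartanSet_eq`** — the «W-UNFOLDED» form consumed by the (A-3) assembly of ROAD «UP-TR»: for `K : T → ℂ` NOT conjugation invariant and the ORBIT SUM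
  `κ_K(y) = Σ_{t ∈ T, t ∼ y} K(t)` (`∑ᶠ` with `Set.indicator`, decidability-free), `∫_{G_T} f κ_K dν = ∫_{T^{reg}} D(t) • (K(t) · classOrbitalIntegral mQv f ⟦t⟧) dtT` with NO `[N:T]⁻¹`:
  (b) at the class function `κ_K`, then `orbitSum_eq_sum_quotient` (TORSOR: `κ_K(t) = Σ_{n̄ ∈ N(T)∕T} K(n t n⁻¹)`, ★ `mem_normalizer_of_conj_eq`) and `exists_conj_continuousMulEquiv_map_eq`
  (`N(T)` acts on `T` by `tT`-preserving automorphisms: Haar uniqueness on the intrinsic compact core, ★ `eq_of_apply_compactCore_eq_one`, ★ `image_compactCore`) unfold the `[N:T]`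
  translates.  (c) carries BOTH integrability binders (`f · κ_K` on `G_T` AND `D • (K · Φ_G)` on `T^{reg}`): for sign-changing `K` the second is NOT implied by the first (the
  `W`-translates of a non-integrable `K` can cancel in `κ_K`; LH1-p03 (g10)'s statement-first box 2026-09-02), and Lean's Bochner integral of a non-integrable function is `0`.
HONEST LABEL: count-neutral; UP-TR block consequents move only at the rider editions; organs 2 = 2; h413 registry untouched; HC_CM is proved only modulo the printed citations
until rung 0 closes.

## References
* [Rogawski1990] J. D. Rogawski, *Automorphic Representations of Unitary Groups in Three Variables*, Ann. of Math. Stud. 123 (1990), §12.5 p. 182 (Weyl integration formula; «the map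
  `(g, γ) ↦ g γ g⁻¹` is `|Ω(T,G)|`-to-one»), §4.3 (4.3.1) p. 43, §1.7 p. 6.
* [HarishChandra1970] Harish-Chandra (notes by G. van Dijk), *Harmonic analysis on reductive p-adic groups*, LNM 162 (1970), Part V §4 Lemma 22, Lemma 42.
* [DeitmarEchterhoff2014] A. Deitmar, S. Echterhoff, *Principles of Harmonic Analysis*, 2nd ed. (2014), Thm. 1.5.3 (quotient integral formula ∕ Haar uniqueness).
-/

set_option autoImplicit false
-- the mandated namespace has the single-problem summit's repeated segment (`HodgeConjecture.HodgeConjecture`)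
set_option linter.dupNamespace false

noncomputable section

open MeasureTheory Measure Set Filter Topology Function NumberField IsDedekindDomain Matrix
open Literature.MeasureTheory.Group
open Literature.NumberTheory.Automorphic Literature.NumberTheory.Automorphic.UnitaryGroup Literature.NumberTheory.Rogawski1990
open Literature.NumberTheory.GaloisRepresentations
open Summit.HodgeConjecture.HodgeConjecture.Cruxes.H413
open Summit.HodgeConjecture.HodgeConjecture.Cruxes.H413.F0P3cStCharTSWeylHypMeasure
open Summit.HodgeConjecture.HodgeConjecture.Cruxes.H413.F0P3cStCharTSWeylCartanRadial
open scoped ENNReal NNReal MatrixGroups Pointwise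

namespace Summit.HodgeConjecture.HodgeConjecture.Cruxes.H413.F0P3cStCharTSUpTrTubeOrbitSum

open Summit.HodgeConjecture.HodgeConjecture.Cruxes.H413.F0P3cStCharTSUpTrTubeSocketAnyCartan
open Summit.HodgeConjecture.HodgeConjecture.Cruxes.H413.F0P3cStCharTSUpTrTubeAnyCartan
open Summit.HodgeConjecture.HodgeConjecture.Cruxes.H413.F0P3cStCharTSWeylCartanOrbInt

section OrbitSum

variable (L : Type) [Field L] [NumberField L] [IsCMField L] (v : HeightOneSpectrum (𝓞 ↥(maximalRealSubfield L)))

/-! ## §4 (c) The `W`-unfolded form: TORSOR re-indexing of the orbit sum and `W`-invariance of `tT` -/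

/-- **The orbit sum is a class function**: `Σ_{t' ∈ T, t' ∼ x y x⁻¹} K t' = Σ_{t' ∈ T, t' ∼ y} K t'` (conjugacy classes are conjugation invariant).
[cite: Rogawski1990, §12.5 p. 182] -/
theorem orbitSum_conj (T : Subgroup (Gqs L v)) (K : ↥T → ℂ) (x y : Gqs L v) :
    (∑ᶠ t : ↥T, {t' : ↥T | IsConj ((t' : Gqs L v)) (x * y * x⁻¹)}.indicator K t) =
      ∑ᶠ t : ↥T, {t' : ↥T | IsConj ((t' : Gqs L v)) y}.indicator K t := by
  have hxy : IsConj y (x * y * x⁻¹) := isConj_iff.2 ⟨x, rfl⟩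
  have hset : {t' : ↥T | IsConj ((t' : Gqs L v)) (x * y * x⁻¹)} = {t' : ↥T | IsConj ((t' : Gqs L v)) y} :=
    Set.ext fun t' => ⟨fun h => h.trans hxy.symm, fun h => h.trans hxy⟩
  rw [hset]

/-- **TORSOR re-indexing of the orbit sum at a regular `t ∈ T = Z(γ₀)`**: the elements of `T` conjugate (in `G`) to `t` are exactly the `n t n⁻¹`, `n ∈ N_G(T)`, each hit by
exactly one coset of `T` in `N_G(T)` (`n t n⁻¹ = n′ t n′⁻¹ ⟺ n⁻¹ n′ ∈ Z(t) = T`; conjugating one `T`-regular element of `T` to another normalises `T`, ★ `mem_normalizer_of_conj_eq`), so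
`Σ_{t' ∈ T, t' ∼ t} K t' = Σ_{n̄ ∈ N_G(T)∕T} K(n t n⁻¹)` («the map `(g, γ) ↦ g γ g⁻¹` is `|Ω(T,G)|`-to-one»). [cite: Rogawski1990, §12.5 p. 182] [cite: HarishChandra1970, Lemma 42] -/
theorem orbitSum_eq_sum_quotient {T : Subgroup (Gqs L v)} {γ₀ : Gqs L v} (hγ₀ : IsRegularElt (γ₀.val : GL (Fin 3) (UnitaryGroup.LocalRing L v)))
    (hT : T = Subgroup.centralizer ({γ₀} : Set (Gqs L v)))
    (K : ↥T → ℂ) (t : ↥T) (ht : IsRegularElt (((t : Gqs L v)).val : GL (Fin 3) (UnitaryGroup.LocalRing L v))) :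
    (∑ᶠ t' : ↥T, {t' : ↥T | IsConj ((t' : Gqs L v)) (t : Gqs L v)}.indicator K t') =
      ∑ᶠ w : ↥(Subgroup.normalizer (T : Set (Gqs L v))) ⧸ (T.subgroupOf (Subgroup.normalizer (T : Set (Gqs L v)))),
        K ⟨((w.out : ↥(Subgroup.normalizer (T : Set (Gqs L v)))) : Gqs L v) * (t : Gqs L v) * (((w.out : ↥(Subgroup.normalizer (T : Set (Gqs L v)))) : Gqs L v))⁻¹,
          (Subgroup.mem_normalizer_iff.1 (w.out).2 (t : Gqs L v)).1 t.2⟩ := by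
  classical
  set N : Subgroup (Gqs L v) := Subgroup.normalizer (T : Set (Gqs L v)) with hN
  have hTa : ∀ a ∈ T, ∀ b ∈ T, a * b = b * a := mul_comm_cartan hγ₀ hT
  have hZt : Subgroup.centralizer ({(t : Gqs L v)} : Set (Gqs L v)) = T := centralizer_eq_cartan_of_isRegularElt hγ₀ hT t ht
  -- the parametrisation `ψ : N ⧸ (T ∩ N) → T`, `n̄ ↦ n t n⁻¹`
  set ψ : ↥N ⧸ (T.subgroupOf N) → ↥T := fun w =>
    ⟨((w.out : ↥N) : Gqs L v) * (t : Gqs L v) * (((w.out : ↥N)) : Gqs L v)⁻¹, (Subgroup.mem_normalizer_iff.1 (w.out).2 (t : Gqs L v)).1 t.2⟩ with hψ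
  -- `ψ` is injective: `n t n⁻¹ = n' t n'⁻¹ ⟹ n'⁻¹ n ∈ Z(t) = T ⟹ n̄ = n̄'`
  have hinj : Function.Injective ψ := by
    intro w w' h
    have h1 : ((w.out : ↥N) : Gqs L v) * (t : Gqs L v) * (((w.out : ↥N)) : Gqs L v)⁻¹ =
        ((w'.out : ↥N) : Gqs L v) * (t : Gqs L v) * (((w'.out : ↥N)) : Gqs L v)⁻¹ := congrArg (fun s : ↥T => (s : Gqs L v)) h
    have h2 : ((((w'.out : ↥N)) : Gqs L v)⁻¹ * ((w.out : ↥N) : Gqs L v)) * (t : Gqs L v) =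
        (t : Gqs L v) * ((((w'.out : ↥N)) : Gqs L v)⁻¹ * ((w.out : ↥N) : Gqs L v)) := by
      calc (((w'.out : ↥N)) : Gqs L v)⁻¹ * ((w.out : ↥N) : Gqs L v) * (t : Gqs L v)
          = (((w'.out : ↥N)) : Gqs L v)⁻¹ * (((w.out : ↥N) : Gqs L v) * (t : Gqs L v) * (((w.out : ↥N)) : Gqs L v)⁻¹) * ((w.out : ↥N) : Gqs L v) := by group
        _ = (((w'.out : ↥N)) : Gqs L v)⁻¹ * (((w'.out : ↥N) : Gqs L v) * (t : Gqs L v) * (((w'.out : ↥N)) : Gqs L v)⁻¹) * ((w.out : ↥N) : Gqs L v) := by rw [h1]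
        _ = (t : Gqs L v) * ((((w'.out : ↥N)) : Gqs L v)⁻¹ * ((w.out : ↥N) : Gqs L v)) := by group
    have hmem' : (((w'.out : ↥N)) : Gqs L v)⁻¹ * ((w.out : ↥N) : Gqs L v) ∈ Subgroup.centralizer ({(t : Gqs L v)} : Set (Gqs L v)) := by
      rw [Subgroup.mem_centralizer_singleton_iff]
      exact h2
    have hmem : (((w'.out : ↥N)) : Gqs L v)⁻¹ * ((w.out : ↥N) : Gqs L v) ∈ T := by
      rw [hZt] at hmem'
      exact hmem'
    have hq : (QuotientGroup.mk (w'.out) : ↥N ⧸ (T.subgroupOf N)) = QuotientGroup.mk (w.out) := by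
      rw [QuotientGroup.eq, Subgroup.mem_subgroupOf]
      simpa only [Subgroup.coe_mul, Subgroup.coe_inv] using hmem
    rw [QuotientGroup.out_eq', QuotientGroup.out_eq'] at hq
    exact hq.symm
  -- its range is the set of `T`-elements conjugate to `t`
  have hrange : Set.range ψ = {t' : ↥T | IsConj ((t' : Gqs L v)) (t : Gqs L v)} := by
    ext t'
    constructor
    · rintro ⟨w, rfl⟩
      exact isConj_iff.2 ⟨(((w.out : ↥N)) : Gqs L v)⁻¹, by simp only [hψ]; group⟩
    · intro ht'
      obtain ⟨c, hc⟩ := isConj_iff.1 ht'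
      -- `n := c⁻¹` conjugates `t` to `t'`, hence normalises `T`
      have hconj : c⁻¹ * (t : Gqs L v) * c⁻¹⁻¹ = (t' : Gqs L v) := by
        rw [inv_inv, ← hc]; group
      have ht'reg : IsRegularElt (((t' : Gqs L v)).val : GL (Fin 3) (UnitaryGroup.LocalRing L v)) := by
        rw [← hconj]; exact (isRegularElt_conj_val_iff L v c⁻¹ (t : Gqs L v)).2 ht
      have hZt' : Subgroup.centralizer ({(t' : Gqs L v)} : Set (Gqs L v)) = T := centralizer_eq_cartan_of_isRegularElt hγ₀ hT t' ht'reg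
      have hnN : c⁻¹ ∈ N := mem_normalizer_of_conj_eq T hZt hZt' hconj
      obtain ⟨s, hs⟩ := QuotientGroup.mk_out_eq_mul (s := T.subgroupOf N) (⟨c⁻¹, hnN⟩ : ↥N)
      refine ⟨QuotientGroup.mk ⟨c⁻¹, hnN⟩, Subtype.ext ?_⟩
      simp only [hψ, hs, Subgroup.coe_mul]
      have hsT : ((s : ↥N) : Gqs L v) ∈ T := Subgroup.mem_subgroupOf.1 s.2
      have hst : ((s : ↥N) : Gqs L v) * (t : Gqs L v) = (t : Gqs L v) * ((s : ↥N) : Gqs L v) := hTa _ hsT _ t.2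
      calc (c⁻¹ * ((s : ↥N) : Gqs L v)) * (t : Gqs L v) * (c⁻¹ * ((s : ↥N) : Gqs L v))⁻¹
          = c⁻¹ * (((s : ↥N) : Gqs L v) * (t : Gqs L v)) * ((s : ↥N) : Gqs L v)⁻¹ * c⁻¹⁻¹ := by group
        _ = c⁻¹ * ((t : Gqs L v) * ((s : ↥N) : Gqs L v)) * ((s : ↥N) : Gqs L v)⁻¹ * c⁻¹⁻¹ := by rw [hst]
        _ = (t' : Gqs L v) := by rw [← hconj]; group
  rw [← finsum_mem_def, ← hrange, finsum_mem_range hinj]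

/-- **`N_G(T)` acts on `T = Z(γ₀)` by measure-preserving automorphisms**: for `n ∈ N_G(T)` there is an isomorphism of topological groups `c : T ≃ₜ* T`, `c t = n t n⁻¹`, and
`c_* tT = tT` for THE Haar measure `tT` with mass one on `compactCore T` (Haar uniqueness on the intrinsic compact core, ★ `image_compactCore`, ★ `eq_of_apply_compactCore_eq_one`) — the
`W`-invariance of `dγ` in the Weyl integration formula. [cite: Rogawski1990, §12.5 p. 182; §1.7 p. 6] [cite: DeitmarEchterhoff2014, Thm. 1.5.3] -/
theorem exists_conj_continuousMulEquiv_map_eq {T : Subgroup (Gqs L v)} {γ₀ : Gqs L v}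
    (hT : T = Subgroup.centralizer ({γ₀} : Set (Gqs L v)))
    [MeasurableSpace (Gqs L v)] [BorelSpace (Gqs L v)] [LocallyCompactSpace (Gqs L v)] [SecondCountableTopology (Gqs L v)] [T2Space (Gqs L v)]
    (tT : Measure ↥T) [tT.IsHaarMeasure] (htT : tT (compactCore ↥T) = 1)
    (n : Gqs L v) (hn : n ∈ Subgroup.normalizer (T : Set (Gqs L v))) :
    ∃ c : ↥T ≃ₜ* ↥T, (∀ t : ↥T, ((c t : ↥T) : Gqs L v) = n * (t : Gqs L v) * n⁻¹) ∧ Measure.map c tT = tT := by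
  have hTcl := isClosed_cartan hT
  set e : Gqs L v ≃* Gqs L v := MulAut.conj n with he_def
  have he : Continuous e := by
    have : (⇑e : Gqs L v → Gqs L v) = fun g => n * g * n⁻¹ := funext fun g => by rw [he_def, MulAut.conj_apply]
    rw [this]; fun_prop
  have hes : Continuous e.symm := by
    have : (⇑e.symm : Gqs L v → Gqs L v) = fun g => n⁻¹ * g * n := funext fun g => by rw [he_def, MulAut.conj_symm_apply]
    rw [this]; fun_prop
  have hTT : ∀ g : Gqs L v, e g ∈ T ↔ g ∈ T := fun g => by
    rw [he_def, MulAut.conj_apply]; exact ((Subgroup.mem_normalizer_iff.1 hn) g).symm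
  set eT := subgroupCongrHomeomorph e T T hTT he hes with heT
  let c : ↥T ≃ₜ* ↥T :=
    { toMulEquiv :=
        { toEquiv := eT.toEquiv
          map_mul' := fun a b => Subtype.ext (by
            show ((eT (a * b) : ↥T) : Gqs L v) = (eT a : Gqs L v) * (eT b : Gqs L v)
            rw [heT, coe_subgroupCongrHomeomorph_apply, coe_subgroupCongrHomeomorph_apply, coe_subgroupCongrHomeomorph_apply, Subgroup.coe_mul, map_mul]) }
      continuous_toFun := eT.continuous
      continuous_invFun := eT.symm.continuous }
  have hc : ∀ t : ↥T, ((c t : ↥T) : Gqs L v) = n * (t : Gqs L v) * n⁻¹ := fun t => by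
    show ((eT t : ↥T) : Gqs L v) = _
    rw [heT, coe_subgroupCongrHomeomorph_apply, he_def, MulAut.conj_apply]
  refine ⟨c, hc, ?_⟩
  haveI : LocallyCompactSpace ↥T := hTcl.isClosedEmbedding_subtypeVal.locallyCompactSpace
  haveI : SecondCountableTopology ↥T := TopologicalSpace.Subtype.secondCountableTopology _
  haveI : (Measure.map c tT).IsHaarMeasure := ContinuousMulEquiv.isHaarMeasure_map tT c
  refine eq_of_apply_compactCore_eq_one _ _ ?_ htT
  have hme : MeasurableEmbedding (⇑c) := c.toHomeomorph.measurableEmbedding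
  rw [← image_compactCore c, hme.map_apply, c.injective.preimage_image, htT]

set_option maxHeartbeats 1600000 in
set_option synthInstance.maxHeartbeats 400000 in
-- instance-term unification on the CM local carrier (as ★ (E2b))
/-- **(N4-c) THE «W-UNFOLDED» FORM AT ANY CARTAN `T = Z(γ₀)`.**  For `K : T → ℂ` ARBITRARY (NOT conjugation invariant) let `κ_K(y) := Σ_{t ∈ T, t ∼ y} K(t)` — the ORBIT SUM
(written `∑ᶠ t : T, 𝟙[t ∼ y] K t` with `Set.indicator`), a class function of `y` with exactly `[N(T):T]` terms on `G_T` (TORSOR).  For `mQv` canonical, `f` measurable with `f · κ_K`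
integrable on `G_T`, and the torus-side integrand `t ↦ D(t) • (K t · Φ_G([t], f))` integrable on `T^{reg}`:
**`∫_{G_T} f κ_K dν = ∫_{t ∈ T^{reg}} √(∏_w |disc χ_t|_w (∏_w |det t|_w)⁻²) • (K(t) · classOrbitalIntegral mQv f ⟦t⟧) dtT`** — NO `[N(T):T]⁻¹`: the class-function form (N4-b) at `κ_K` gives
`[N:T]⁻¹ ∫ D • (κ_K · Φ_G)`, and `κ_K(t) = Σ_{n̄ ∈ N(T)∕T} K(n t n⁻¹)` (TORSOR) unfolds against the `N(T)`-invariant measure `D · Φ_G([·],f) · tT|_{T^{reg}}` (`D`, `Φ_G([·],f)`, `T^{reg}` are class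
objects; `tT` is `N(T)`-invariant by Haar uniqueness on the compact core) to `[N:T] ∫ D • (K · Φ_G)` («the map `(g, γ) ↦ g γ g⁻¹` is `|Ω(T,G)|`-to-one»).  The torus-side integrability is
NOT implied by the `G`-side one for sign-changing `K` (the `W`-translates of a non-integrable `K` can cancel), hence both are hypotheses ((A0)'s to supply).
[cite: Rogawski1990, §12.5 p. 182] [cite: HarishChandra1970, Lemma 42] -/
theorem setIntegral_mul_orbitSum_cartanSet_eq
    (hns : ∀ w : PlacesOver L v, IsCMField.complexConj L • w.1 = w.1)
    [MeasurableSpace (Gqs L v)] [BorelSpace (Gqs L v)] [LocallyCompactSpace (Gqs L v)] [SecondCountableTopology (Gqs L v)] [T2Space (Gqs L v)]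
    [∀ γ' : Gqs L v, MeasurableSpace (Gqs L v ⧸ Subgroup.centralizer ({γ'} : Set (Gqs L v)))]
    [∀ γ' : Gqs L v, BorelSpace (Gqs L v ⧸ Subgroup.centralizer ({γ'} : Set (Gqs L v)))]
    (ν : Measure (Gqs L v)) [ν.IsHaarMeasure] [ν.IsMulRightInvariant]
    {mQv : OrbitalMeasureFamily (Gqs L v)} (hcanQ : mQv.IsCanonical (fun γ' => IsRegularElt (γ'.val : GL (Fin 3) (UnitaryGroup.LocalRing L v))) ν)
    {T : Subgroup (Gqs L v)} {γ₀ : Gqs L v} (hγ₀ : IsRegularElt (γ₀.val : GL (Fin 3) (UnitaryGroup.LocalRing L v)))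
    (hT : T = Subgroup.centralizer ({γ₀} : Set (Gqs L v)))
    [MeasurableSpace (Gqs L v ⧸ T)] [BorelSpace (Gqs L v ⧸ T)]
    (tT : Measure ↥T) [tT.IsHaarMeasure] [tT.IsInvInvariant] (htT : tT (compactCore ↥T) = 1)
    (f : Gqs L v → ℂ) (hf : Measurable f) (K : ↥T → ℂ)
    (hfκ : IntegrableOn (fun y => f y * ∑ᶠ t : ↥T, {t' : ↥T | IsConj ((t' : Gqs L v)) y}.indicator K t)
      {x | ∃ g t : Gqs L v, t ∈ T ∧ IsRegularElt (t.val : GL (Fin 3) (UnitaryGroup.LocalRing L v)) ∧ g * t * g⁻¹ = x} ν)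
    (hK : IntegrableOn (fun t : ↥T =>
        ((NNReal.sqrt
            ((∏ w : PlacesOver L v, IsNonarchimedeanLocalField.normAbs (w.1.adicCompletion L)
                ((((t : Gqs L v).val : GL (Fin 3) (UnitaryGroup.LocalRing L v)).val.charpoly.discr) w)) *
              ((∏ w : PlacesOver L v, IsNonarchimedeanLocalField.normAbs (w.1.adicCompletion L)
                ((((t : Gqs L v).val : GL (Fin 3) (UnitaryGroup.LocalRing L v)).val.det) w)) ^ 2)⁻¹) : ℝ≥0) : ℝ) •
          (K t * classOrbitalIntegral mQv f (ConjClasses.mk (t : Gqs L v))))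
      {t : ↥T | IsRegularElt (((t : Gqs L v)).val : GL (Fin 3) (UnitaryGroup.LocalRing L v))} tT) :
    ∫ y in {x | ∃ g t : Gqs L v, t ∈ T ∧ IsRegularElt (t.val : GL (Fin 3) (UnitaryGroup.LocalRing L v)) ∧ g * t * g⁻¹ = x},
        f y * ∑ᶠ t : ↥T, {t' : ↥T | IsConj ((t' : Gqs L v)) y}.indicator K t ∂ν =
      ∫ t in {t : ↥T | IsRegularElt (((t : Gqs L v)).val : GL (Fin 3) (UnitaryGroup.LocalRing L v))},
        ((NNReal.sqrt
            ((∏ w : PlacesOver L v, IsNonarchimedeanLocalField.normAbs (w.1.adicCompletion L)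
                ((((t : Gqs L v).val : GL (Fin 3) (UnitaryGroup.LocalRing L v)).val.charpoly.discr) w)) *
              ((∏ w : PlacesOver L v, IsNonarchimedeanLocalField.normAbs (w.1.adicCompletion L)
                ((((t : Gqs L v).val : GL (Fin 3) (UnitaryGroup.LocalRing L v)).val.det) w)) ^ 2)⁻¹) : ℝ≥0) : ℝ) •
          (K t * classOrbitalIntegral mQv f (ConjClasses.mk (t : Gqs L v))) ∂tT := by
  classical
  -- ### notation-free abbreviations
  set D : ↥T → ℝ≥0 := fun t => NNReal.sqrt
      ((∏ w : PlacesOver L v, IsNonarchimedeanLocalField.normAbs (w.1.adicCompletion L)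
          ((((t : Gqs L v).val : GL (Fin 3) (UnitaryGroup.LocalRing L v)).val.charpoly.discr) w)) *
        ((∏ w : PlacesOver L v, IsNonarchimedeanLocalField.normAbs (w.1.adicCompletion L)
          ((((t : Gqs L v).val : GL (Fin 3) (UnitaryGroup.LocalRing L v)).val.det) w)) ^ 2)⁻¹) with hDdef
  set O : ↥T → ℂ := fun t => classOrbitalIntegral mQv f (ConjClasses.mk (t : Gqs L v)) with hOdef
  set κ : Gqs L v → ℂ := fun y => ∑ᶠ t : ↥T, {t' : ↥T | IsConj ((t' : Gqs L v)) y}.indicator K t with hκdef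
  set Treg : Set ↥T := {t : ↥T | IsRegularElt (((t : Gqs L v)).val : GL (Fin 3) (UnitaryGroup.LocalRing L v))} with hTreg
  set N : Subgroup (Gqs L v) := Subgroup.normalizer (T : Set (Gqs L v)) with hN
  have hW0 := index_cartan_subgroupOf_normalizer_ne_zero hγ₀ hT hns
  haveI : (T.subgroupOf N).FiniteIndex := ⟨hW0⟩
  haveI : Fintype (↥N ⧸ (T.subgroupOf N)) := Fintype.ofFinite _
  obtain ⟨w₀⟩ := (inferInstance : Nonempty (PlacesOver L v))
  have hTregm : MeasurableSet Treg :=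
    ((isOpen_setOf_isRegularElt_cmDatum_local (L := L) (H := qsForm L) (v := v) w₀ (hns w₀)).preimage continuous_subtype_val).measurableSet
  -- ### Step 1: `κ` is a class function; the class-function form (N4-b)
  have hκcl : ∀ x y : Gqs L v, IsRegularElt (y.val : GL (Fin 3) (UnitaryGroup.LocalRing L v)) → κ (x * y * x⁻¹) = κ y :=
    fun x y _ => orbitSum_conj L v T K x y
  rw [setIntegral_mul_classFun_cartanSet_eq L v hns ν hcanQ hγ₀ hT tT htT f κ hf hκcl hfκ]
  -- ### Step 2: unfold the orbit sum against the `N(T)`-invariant measure: `∫_{T^{reg}} D • (κ · O) = [N:T] • ∫_{T^{reg}} D • (K · O)`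
  have hidx : (((T.subgroupOf N).index : ℝ)) ≠ 0 := Nat.cast_ne_zero.2 hW0
  rw [inv_smul_eq_iff₀ hidx]
  -- the `T^{reg}`-indicator of the torus integrand `D • (K' · O)` for a function `K'` on `T`
  -- (a) each `W`-translate of `K` has the same `T^{reg}`-integral as `K`, and is integrable there
  have htrans : ∀ w : ↥N ⧸ (T.subgroupOf N),
      IntegrableOn (fun t : ↥T => (D t : ℝ) •
        (K ⟨((w.out : ↥N) : Gqs L v) * (t : Gqs L v) * (((w.out : ↥N)) : Gqs L v)⁻¹, (Subgroup.mem_normalizer_iff.1 (w.out).2 (t : Gqs L v)).1 t.2⟩ * O t)) Treg tT ∧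
      ∫ t in Treg, (D t : ℝ) •
        (K ⟨((w.out : ↥N) : Gqs L v) * (t : Gqs L v) * (((w.out : ↥N)) : Gqs L v)⁻¹, (Subgroup.mem_normalizer_iff.1 (w.out).2 (t : Gqs L v)).1 t.2⟩ * O t) ∂tT =
        ∫ t in Treg, (D t : ℝ) • (K t * O t) ∂tT := by
    intro w
    obtain ⟨c, hc, hcmap⟩ := exists_conj_continuousMulEquiv_map_eq L v hT tT htT ((w.out : ↥N) : Gqs L v) (w.out).2
    have hpres : MeasurePreserving (⇑c) tT tT := ⟨c.continuous.measurable, hcmap⟩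
    -- the translate IS `(indicator of the integrand) ∘ c`
    have hct : ∀ t : ↥T, c t = ⟨((w.out : ↥N) : Gqs L v) * (t : Gqs L v) * (((w.out : ↥N)) : Gqs L v)⁻¹,
        (Subgroup.mem_normalizer_iff.1 (w.out).2 (t : Gqs L v)).1 t.2⟩ := fun t => Subtype.ext (hc t)
    have hcreg : ∀ t : ↥T, c t ∈ Treg ↔ t ∈ Treg := fun t => by
      simp only [hTreg, Set.mem_setOf_eq, hc t]
      exact isRegularElt_conj_val_iff L v _ _
    have hcD : ∀ t : ↥T, D (c t) = D t := fun t => by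
      simp only [hDdef, hc t]
      exact sqrt_dgRadicand_conj L v (t : Gqs L v) _
    have hcO : ∀ t : ↥T, O (c t) = O t := fun t => by
      simp only [hOdef, hc t]
      exact congrArg _ (ConjClasses.mk_eq_mk_iff_isConj.2 (isConj_iff.2 ⟨(((w.out : ↥N)) : Gqs L v)⁻¹, by group⟩))
    have hcomp : (Treg.indicator fun t : ↥T => (D t : ℝ) • (K t * O t)) ∘ c =
        Treg.indicator fun t : ↥T => (D t : ℝ) •
          (K ⟨((w.out : ↥N) : Gqs L v) * (t : Gqs L v) * (((w.out : ↥N)) : Gqs L v)⁻¹, (Subgroup.mem_normalizer_iff.1 (w.out).2 (t : Gqs L v)).1 t.2⟩ * O t) := by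
      funext t
      simp only [Function.comp_apply]
      by_cases hmem : t ∈ Treg
      · rw [Set.indicator_of_mem ((hcreg t).2 hmem), Set.indicator_of_mem hmem, hcD, hcO, hct]
      · rw [Set.indicator_of_notMem (fun h => hmem ((hcreg t).1 h)), Set.indicator_of_notMem hmem]
    have hint : Integrable (Treg.indicator fun t : ↥T => (D t : ℝ) • (K t * O t)) tT := (integrable_indicator_iff hTregm).2 hK
    constructor
    · rw [← integrable_indicator_iff hTregm, ← hcomp]
      exact hpres.integrable_comp_of_integrable hint
    · rw [← integral_indicator hTregm, ← integral_indicator hTregm, ← hcomp]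
      exact hpres.integral_comp' (f := c.toHomeomorph.toMeasurableEquiv) _
  -- (b) unfold: TORSOR pointwise on `T^{reg}`, then sum ∕ integral exchange and (a)
  calc ∫ t in Treg, (D t : ℝ) • (κ (t : Gqs L v) * O t) ∂tT
      = ∫ t in Treg, ∑ w : ↥N ⧸ (T.subgroupOf N), (D t : ℝ) •
          (K ⟨((w.out : ↥N) : Gqs L v) * (t : Gqs L v) * (((w.out : ↥N)) : Gqs L v)⁻¹, (Subgroup.mem_normalizer_iff.1 (w.out).2 (t : Gqs L v)).1 t.2⟩ * O t) ∂tT := by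
        refine setIntegral_congr_fun hTregm fun t ht => ?_
        simp only [hκdef]
        rw [orbitSum_eq_sum_quotient L v hγ₀ hT K t ht, finsum_eq_sum_of_fintype, Finset.sum_mul, Finset.smul_sum]
    _ = ∑ w : ↥N ⧸ (T.subgroupOf N), ∫ t in Treg, (D t : ℝ) •
          (K ⟨((w.out : ↥N) : Gqs L v) * (t : Gqs L v) * (((w.out : ↥N)) : Gqs L v)⁻¹, (Subgroup.mem_normalizer_iff.1 (w.out).2 (t : Gqs L v)).1 t.2⟩ * O t) ∂tT :=
        integral_finsetSum _ fun w _ => (htrans w).1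
    _ = ∑ _w : ↥N ⧸ (T.subgroupOf N), ∫ t in Treg, (D t : ℝ) • (K t * O t) ∂tT := Finset.sum_congr rfl fun w _ => (htrans w).2
    _ = ((T.subgroupOf N).index : ℝ) • ∫ t in Treg, (D t : ℝ) • (K t * O t) ∂tT := by
        rw [Finset.sum_const, Finset.card_univ, ← Nat.card_eq_fintype_card, ← Subgroup.index_eq_card, Nat.cast_smul_eq_nsmul]

end OrbitSum

end Summit.HodgeConjecture.HodgeConjecture.Cruxes.H413.F0P3cStCharTSUpTrTubeOrbitSum

end
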